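import Summits.ResolutionOfSingularities.ResolutionOfSingularities.Theorems.HilbertSamuelEliminationSigmaMaxModificationsCorridor3Theorem314OfThmIV
import Summits.ResolutionOfSingularities.ResolutionOfSingularities.Theorems.HilbertSamuelEliminationCampaignW42ThmIVOfFormallySmooth
import HarnessLib

/-!
# [OURS · L1 W4.2] CJS Thm. 3.14 (numerical form `dim 𝒪_{D,x} < e_x(X)`) POINTWISE from Theorem IV AT THE POINT — hence
# UNCONDITIONALLY at near points over perfect `κ(x)`, and in residue characteristic `0` with no hypothesis at all
# (campaign s42, cell res-hironaka; `--supports` stmt-ResolutionOfSingularities-17845)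

HONEST FRAMING. OURS (slot W4.2, prover res-L1-s42-pv-1, gen 7). res-D-lib-1's `Directrix214Sharp.cjs_thm_3_14_of_thmIV`
(`Hironaka1970_thmIV → CossartJannsenSaito2020_thm_3_14`, p5203xx) uses the named fact F-51′ exactly once, at the point in
question. This file re-runs that proof VERBATIM with the global fact replaced by THEOREM IV AT THE POINT `x'` (the hypothesis
`hIV`, Th. IV's inner statement for every minimal system of generators and every chart datum at `x'`) —
`dim_lt_dirDim_of_thmIVAt`; of the near-point hypothesis NOTHING ELSE is used — and feeds it this campaign's PROVED instances of Theorem IV: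

* **`dim_lt_dirDim_of_near_of_perfectField`** — CJS Thm. 3.14 (numerical form, printed characteristic hypothesis
  `CharHypothesis X x`) at every near point (any level `N`, no `N ≥ dim X` needed) over a point `x ∈ D` with PERFECT
  residue field, NO named fact;
* **`dim_lt_dirDim_of_near_of_charZero`** — in residue characteristic `0` the characteristic hypothesis is automatic and
  `κ(x)` is perfect: **CJS Thm. 3.14 holds outright** (`x'` near ⇒ `dim 𝒪_{D,x} < e_x(X)`), no hypothesis beyond the data.

The Theorem-IV instances are `normalConeIdeal_le_span_inter_multAlgebra_of_perfectField` (`…CampaignW42ThmIVOfFormallySmooth`).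
Everything else is as in the copied proof (credit: res-D-lib-1 g5; inputs F-52 `Hironaka1970_thm1_cor_holds`, F-50b Mizutani
`mizutani1973_vectorGroup_of_dim_le_of_hironaka`, F-split `HerrmannIkedaOrbanz1988_cor_21_11_holds`,
`directrixSpace_le_prime_of_charZero` — all tree theorems). NOT a statement of H. Hironaka's manuscript [Hironaka2017]; the
statement proved is CJS's Thm. 3.14 at the given point. AI-written; AI review is weaker than expert review.
-/

set_option linter.dupNamespace false

noncomputable section

open CategoryTheory AlgebraicGeometry TopologicalSpace IsLocalRing MvPolynomial
open Literature.AlgebraicGeometry.Resolution Literature.AlgebraicGeometry.Resolution.HironakaScheme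
open Literature.RingTheory.HilbertSamuel Literature.RingTheory.MvPolynomial
open Literature.AlgebraicGeometry.CossartJannsenSaito2020
open Summit.ResolutionOfSingularities.KangarooAtlas.Mizutani
open Summit.ResolutionOfSingularities.ResolutionOfSingularities.Theorems.SigmaMaxModificationsCorridor3.Directrix214Sharp

namespace Summit.ResolutionOfSingularities.ResolutionOfSingularities.Theorems

namespace CampaignW42

universe u

/-- **CJS Thm. 3.14 (numerical form) at a point, from THE CONCLUSION OF THEOREM IV AT THAT POINT**: `X` locally
noetherian, `D` permissible, `π` a blow-up in `D`, `x'` over `x ∈ D` with `CharHypothesis X x`; if Th. IV's conclusion holds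
at `x'` for every minimal system of generators of `I_{D,x}` and every chart datum (`hIV` — this is where nearness, excellence
and the level enter), then `dim 𝒪_{D,x} < e_x(X)`. Proof copied from `Directrix214Sharp.cjs_thm_3_14_of_thmIV` (res-D-lib-1)
with `h51 …` replaced by `hIV`; nothing else of the near-point hypothesis is used. [cite: CossartJannsenSaito2020, Thm. 3.14 and its proof p. 51–52] -/
theorem dim_lt_dirDim_of_thmIVAt {X X' : Scheme.{u}} [IsLocallyNoetherian X] (π : X' ⟶ X)
    (D : X.IdealSheafData) (hperm : IdealSheafData.IsPermissible D) (hπ : IsBlowup π D)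
    (x' : X') (hxD : π.base x' ∈ D.support) (hCH : CharHypothesis X (π.base x'))
    (hIV : ∀ (m : ℕ) (g : Fin m → X.presheaf.stalk (π.base x'))
        (t : X'.presheaf.stalk x') (u : Fin m → X'.presheaf.stalk x'),
        Ideal.span (Set.range g) = stalkIdeal D (π.base x') →
        (stalkIdeal D (π.base x')).spanFinrank = m →
        t ∈ nonZeroDivisors (X'.presheaf.stalk x') →
        (stalkIdeal D (π.base x')).map (π.stalkMap x').hom = Ideal.span {t} →
        (∀ i, (π.stalkMap x').hom (g i) = u i * t) →
          normalConeIdeal g ≤ Ideal.span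
            ((normalConeIdeal g : Set (MvPolynomial (Fin m) (ResidueField (X.presheaf.stalk (π.base x'))))) ∩
              (multAlgebra (ResidueField (X.presheaf.stalk (π.base x'))) (chartPrime (π.stalkMap x').hom u) :
                Set (MvPolynomial (Fin m) (ResidueField (X.presheaf.stalk (π.base x'))))))) :
    ringKrullDim (X.presheaf.stalk (π.base x') ⧸ stalkIdeal D (π.base x')) <
      (Scheme.dirDim X (π.base x') : WithBot ℕ∞) := by
  classical
  set A := X.presheaf.stalk (π.base x') with hA
  set K := ResidueField A with hK
  set B := X'.presheaf.stalk x' with hB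
  set φ : A →+* B := (π.stalkMap x').hom with hφ
  haveI : IsLocalHom φ := π.toLRSHom.prop x'
  -- the permissible centre at `x`
  set I : Ideal A := stalkIdeal D (π.base x') with hI
  have hIperm : I.IsPermissible := hperm _ hxD
  haveI hreg : IsRegularLocalRing (A ⧸ I) := hIperm.isRegularLocalRing
  -- the chart of the exceptional divisor at `x'`
  obtain ⟨t, ht, hspan⟩ := hπ.isEffectiveCartier.exists_stalkIdeal_eq_span x'
  have hmap : I.map φ = Ideal.span {t} := by
    rw [← hspan, stalkIdeal_comap_eq_map_stalkMap]
  -- minimal generators of `I`; `μ(I) ≥ 1` since `I` lies in no minimal prime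
  obtain ⟨g₀, hg₀⟩ := exists_fun_span_eq_of_fg (I := I) (IsNoetherian.noetherian I)
  have hmpos : 0 < I.spanFinrank := by
    by_contra h0
    have h0' : I.spanFinrank = 0 := by omega
    have hIbot : I = ⊥ := by
      rw [← hg₀, Ideal.span_eq_bot]
      rintro _ ⟨i, rfl⟩
      exact Fin.elim0 (Fin.cast h0' i)
    obtain ⟨q, hq, -⟩ := Ideal.exists_minimalPrimes_le (I := (⊥ : Ideal A)) (J := maximalIdeal A) bot_le
    exact hIperm.not_le_of_mem_minimalPrimes hq (hIbot ▸ bot_le)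
  obtain ⟨n, hn⟩ : ∃ n, I.spanFinrank = n + 1 := ⟨_, (Nat.succ_pred_eq_of_pos hmpos).symm⟩
  set g : Fin (n + 1) → A := g₀ ∘ Fin.cast hn.symm with hg
  have hgI : Ideal.span (Set.range g) = I := by
    have hsurj : Function.Surjective (Fin.cast hn.symm) := fun i => ⟨Fin.cast hn i, by simp⟩
    rw [hg, hsurj.range_comp]
    exact hg₀
  have hm : (Ideal.span (Set.range g)).spanFinrank = n + 1 := by rw [hgI, hn]
  -- `π^♯(g_i) = u_i t`
  have hu : ∀ i, ∃ ui : B, φ (g i) = ui * t := by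
    intro i
    have hmem : φ (g i) ∈ I.map φ := by
      refine Ideal.mem_map_of_mem φ ?_
      rw [← hgI]
      exact Ideal.subset_span ⟨i, rfl⟩
    rw [hmap, Ideal.mem_span_singleton'] at hmem
    obtain ⟨ui, hui⟩ := hmem
    exact ⟨ui, hui.symm⟩
  choose u hu using hu
  -- a lift `y` of a regular system of parameters of `A ⧸ I`
  set s := (maximalIdeal (A ⧸ I)).spanFinrank with hs
  have hdimI : ringKrullDim (A ⧸ I) = (s : WithBot ℕ∞) := hreg.spanFinrank_maximalIdeal.symm
  obtain ⟨ybar, hybar⟩ := exists_span_range_eq_maximalIdeal (A ⧸ I) (e := s) le_rfl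
  have hy' : ∀ i, ∃ yi : A, Ideal.Quotient.mk I yi = ybar i := fun i => Ideal.Quotient.mk_surjective (ybar i)
  choose y hy using hy'
  have hz : Ideal.span (Set.range (Fin.append g y)) = maximalIdeal A := by
    have hcomap : (maximalIdeal (A ⧸ I)).comap (Ideal.Quotient.mk I) = maximalIdeal A :=
      IsLocalRing.eq_maximalIdeal
        (Ideal.comap_isMaximal_of_surjective _ Ideal.Quotient.mk_surjective)
    have hybar' : Ideal.span (Set.range ybar) = (Ideal.span (Set.range y)).map (Ideal.Quotient.mk I) := by
      have hfun : ybar = (Ideal.Quotient.mk I) ∘ y := funext fun i => (hy i).symm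
      rw [Ideal.map_span, ← Set.range_comp, hfun]
    rw [SigmaMaxModificationsCorridor3.Directrix214Sharp.range_fin_append, Ideal.span_union, hgI, ← hcomap, ← hybar, hybar',
      Ideal.comap_map_of_surjective _ Ideal.Quotient.mk_surjective]
    rw [sup_comm]
    congr 1
    exact (Ideal.mk_ker (I := I)).symm
  -- Hironaka–Grothendieck (F-split, PROVED): `J_z = J_D · k[Z]`
  have hJz := HerrmannIkedaOrbanz1988_cor_21_11_holds A I (n + 1) s g y hz hgI hreg hIperm.isNormallyFlat hdimI
  -- hence `z` is a minimal system of generators of `𝔪`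
  have hE : (maximalIdeal A).spanFinrank = (n + 1) + s :=
    spanFinrank_maximalIdeal_eq_of_tangentConeIdeal_eq hm hz hJz
  -- F-51′: `J_D` is generated inside `U(𝔭_{x'})`
  set JD := normalConeIdeal g with hJD
  set 𝔭 := Literature.RingTheory.HilbertSamuel.chartPrime φ u with h𝔭
  have h51' : JD ≤ Ideal.span ((JD : Set (MvPolynomial (Fin (n + 1)) K)) ∩
      (multAlgebra K 𝔭 : Set (MvPolynomial (Fin (n + 1)) K))) :=
    hIV (n + 1) g t u hgI hn ht hmap hu
  -- `𝔭_{x'}` is a point of `ℙ(N_{D,x})`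
  haveI : 𝔭.IsPrime := isPrime_chartPrime φ u
  obtain ⟨i₀, hi₀⟩ := exists_X_not_mem_chartPrime_of_map_eq φ hgI ht hmap hu
  have hpt : IsPoint K 𝔭 := by
    refine ⟨isPrime_chartPrime φ u, fun f hf d => homogeneousComponent_mem_chartPrime φ u hf d, ?_⟩
    intro hle
    exact hi₀ (hle (by simp [irrelevant]))
  -- the core, by characteristic: `𝒯(J_D) ⊆ 𝔭_{x'}`
  have hcore : ∀ L ∈ directrixSpace JD, L ∈ 𝔭 := by
    by_cases hc0 : ringChar K = 0
    · -- characteristic `0`: `U(𝔭)` is generated by linear forms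
      haveI : CharP K 0 := ringChar.eq_iff.mp hc0
      haveI : CharZero K := CharP.charP_to_charZero K
      exact fun L hL => directrixSpace_le_prime_of_charZero h51' hL
    · -- characteristic `p`: Mizutani's bound from `dim X + 2 ≤ 2p`
      obtain ⟨d, hd, hor⟩ := hCH
      have hdp : d + 2 ≤ 2 * ringChar K := hor.resolve_left hc0
      set p := ringChar K with hp
      haveI : CharP K p := ringChar.charP K
      haveI hpp : Fact p.Prime := ⟨CharP.char_prime_of_ne_zero K hc0⟩
      -- `ē_x(X) ≤ dim 𝒪_{X,x} ≤ dim X = d`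
      have hgeomle : Scheme.geomDirDim X (π.base x') ≤ d := by
        have h1 : (Scheme.geomDirDim X (π.base x') : WithBot ℕ∞) ≤ ringKrullDim A :=
          Literature.RingTheory.HilbertSamuel.geomDirDim_le_ringKrullDim A
        have h2 : ringKrullDim A ≤ (d : WithBot ℕ∞) :=
          (ringKrullDim_stalk_le_topologicalKrullDim X (π.base x')).trans hd.le
        exact_mod_cast h1.trans h2
      set Kbar := AlgebraicClosure K with hKbar
      haveI : PerfectRing Kbar p := PerfectField.toPerfectRing p
      have hgeomA : Scheme.geomDirDim X (π.base x') = directrixDim ((tangentConeIdeal (Fin.append g y) hz).map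
          (MvPolynomial.map (algebraMap K Kbar))) :=
        dirDimOver_eq' A Kbar hE (Fin.append g y) hz
      have hdir : directrixDim (JD.map (MvPolynomial.map (algebraMap K Kbar))) + 2 ≤ 2 * p := by
        have h1 := directrixDim_add_le_directrixDim_map_rename s (JD.map (MvPolynomial.map (algebraMap K Kbar)))
        rw [← map_map_rename_eq, ← hJz, ← hgeomA] at h1
        calc directrixDim (JD.map (MvPolynomial.map (algebraMap K Kbar))) + 2
            ≤ Scheme.geomDirDim X (π.base x') + 2 := by omega
          _ ≤ d + 2 := by omega
          _ ≤ 2 * p := hdp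
      exact fun L hL => directrixSpace_le_prime_of_facts p Kbar (Hironaka1970_thm1_cor_holds p)
        (mizutani1973_vectorGroup_of_dim_le_of_hironaka p (Hironaka1970_thm1_cor_holds p)) hpt h51' hdir hL
  -- `𝔭_{x'}` misses `X_{i₀}`, so `e(C_{X,D,x}) ≥ 1`
  have hone : 1 ≤ directrixDim JD :=
    one_le_directrixDim_of_not_mem ((mem_homogeneousSubmodule 1 _).mpr (isHomogeneous_X K i₀))
      fun h => hi₀ (hcore _ h)
  -- `e_x(X) = e(J_z) ≥ e(J_D) + s ≥ 1 + s`
  have hdirDim : Scheme.dirDim X (π.base x') = directrixDim (tangentConeIdeal (Fin.append g y) hz) :=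
    dirDim_eq' A hE (Fin.append g y) hz
  have hes : s + 1 ≤ Scheme.dirDim X (π.base x') := by
    have h1 := directrixDim_add_le_directrixDim_map_rename s JD
    rw [← hJz, ← hdirDim] at h1
    omega
  have hlt : s < Scheme.dirDim X (π.base x') := by omega
  show ringKrullDim (A ⧸ I) < (Scheme.dirDim X (π.base x') : WithBot ℕ∞)
  rw [hdimI]
  exact_mod_cast hlt

section Instances

variable {X X' : Scheme.{u}} [IsLocallyNoetherian X]

/-- **CJS Thm. 3.14 (numerical form) at every near point over a point with PERFECT residue field — no named fact.**
[cite: CossartJannsenSaito2020, Thm. 3.14] -/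
theorem dim_lt_dirDim_of_near_of_perfectField (π : X' ⟶ X) (D : X.IdealSheafData) (hexc : Scheme.IsExcellent X)
    (hperm : IdealSheafData.IsPermissible D) (hπ : IsBlowup π D) (N : ℕ)
    (x' : X') (hxD : π.base x' ∈ D.support) (hCH : CharHypothesis X (π.base x'))
    (hnear : Scheme.hsFun X' N x' = Scheme.hsFun X N (π.base x'))
    (hperf : PerfectField (ResidueField (X.presheaf.stalk (π.base x')))) :
    ringKrullDim (X.presheaf.stalk (π.base x') ⧸ stalkIdeal D (π.base x')) <
      (Scheme.dirDim X (π.base x') : WithBot ℕ∞) :=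
  dim_lt_dirDim_of_thmIVAt π D hperm hπ x' hxD hCH
    fun _m g t u hgI _hm ht hmap hu =>
      normalConeIdeal_le_span_inter_multAlgebra_of_perfectField hπ x' (hperm _ hxD)
        (hexc.isUniversallyCatenaryRing_stalk _) hnear g hgI t ht hmap u hu hperf

/-- **CJS Thm. 3.14 (numerical form) IN RESIDUE CHARACTERISTIC `0`, OUTRIGHT**: `X` locally noetherian and excellent of
finite dimension, `D` permissible, `π` a blow-up in `D`, `x'` NEAR to `x = π x' ∈ D` with `char κ(x) = 0`; then
`dim 𝒪_{D,x} < e_x(X)`. (The characteristic hypothesis of Thm. 3.14 holds by its first clause; `κ(x)` is perfect.)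
[cite: CossartJannsenSaito2020, Thm. 3.14] -/
theorem dim_lt_dirDim_of_near_of_charZero (π : X' ⟶ X) (D : X.IdealSheafData) (hexc : Scheme.IsExcellent X)
    (hperm : IdealSheafData.IsPermissible D) (hπ : IsBlowup π D) (N : ℕ)
    (hfin : ∃ d : ℕ, topologicalKrullDim ↥X = (d : WithBot ℕ∞))
    (x' : X') (hxD : π.base x' ∈ D.support) (h0 : CharZero (ResidueField (X.presheaf.stalk (π.base x'))))
    (hnear : Scheme.hsFun X' N x' = Scheme.hsFun X N (π.base x')) :
    ringKrullDim (X.presheaf.stalk (π.base x') ⧸ stalkIdeal D (π.base x')) <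
      (Scheme.dirDim X (π.base x') : WithBot ℕ∞) := by
  haveI := h0
  obtain ⟨d, hd⟩ := hfin
  have hCH : CharHypothesis X (π.base x') := ⟨d, hd, Or.inl (ringChar.eq_zero)⟩
  exact dim_lt_dirDim_of_near_of_perfectField π D hexc hperm hπ N x' hxD hCH hnear inferInstance

end Instances

end CampaignW42

end Summit.ResolutionOfSingularities.ResolutionOfSingularities.Theorems

end
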